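import Summits.CriticalPhenomena.CardyFormulaZ2.Theorems.CardyFlipRussoSquareFromVoronoiHubDilutionDefs
import Mathlib.Algebra.Order.Round
import Mathlib.Data.Set.Card
import HarnessLib

/-!
# Stub `stub_latticeDictionary` of line `poisson-dilution-leg`
# (crux `SquareFromVoronoiHub`, stmt-CriticalPhenomena-6434, route `CardyFlipRusso`)

**The cells-and-hubs dictionary of the lattice end.**  For a lattice-end configuration
`θ = (black sites, black hub coins)` in which both colours occur, the black region of the embedded
leg configuration `toLeg θ` (no Poisson nuclei, every site of `ℤ²` present) is the concrete set
`latBlack θ`: the union of the closed unit squares about the black sites minus the face centres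
whose hub coin is not black.

Pure Euclidean geometry of `ℤ² ⊂ ℂ`, in three facts.

* (i) **The Voronoi cells of `ℤ²` are the closed unit squares.**  If `|z.re - w.1| ≤ 1/2` and
  `|z.im - w.2| ≤ 1/2` then `zZ2 w` is a nearest lattice point of `z` (coordinatewise: an integer
  `a' ≠ a` with `|x - a| ≤ 1/2` has `|x - a'| ≥ 1/2`); otherwise the rounded point
  `(round z.re, round z.im)` is strictly closer.  The distance to a nonempty set of lattice points
  is attained (the set is closed, being `1`-separated, and `ℂ` is proper), whence
  `z ∈ blackRegion (zZ2 '' B) (zZ2 '' Bᶜ) ↔ ∃ v ∈ B, |z.re - v.1| ≤ 1/2 ∧ |z.im - v.2| ≤ 1/2`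
  for `B`, `Bᶜ` nonempty (`mem_blackRegion_image_zZ2_iff`).
* (ii) **The hubs of the full lattice are the face centres.**  The nearest lattice points of `p`
  are `zZ2 '' (I(p.re) ×ˢ I(p.im))` with `I(x) = {a : ℤ | |x - a| ≤ 1/2} ⊆ {⌊x⌋, ⌊x⌋ + 1}`, and
  `I(x)` has two elements iff `x = ⌊x⌋ + 1/2`; so there are at least four of them iff both
  coordinates are half-integers, i.e. `p = zGs (Sum.inr f)` (`mem_hubs_toLeg_iff`).
* (iii) **Coins.** `zQ2` is injective and `zQ2 (hubCoin f) = zGs (Sum.inr f)`, so the face centre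
  of `f` is removed iff `hubCoin f` is not black.

Mathlib only (`abs_sub_round`, `Metric.isClosed_of_pairwise_le_dist`,
`IsClosed.exists_infDist_eq_dist`, `Set.encard_prod`, `Set.one_lt_encard_iff`).
-/

noncomputable section

open scoped Topology
open MeasureTheory Metric Set Filter
open Literature.Analysis.FunctionSpaces (PointConfig IsPoissonPointProcess
  existsUnique_isPoissonPointProcess_holds)
open Literature.Probability.Percolation (SiteConfig sitePercolation half blackRegion voronoiCrossing)
open Literature.Probability.RandomPlanarGeometry (ConformalRectangle cardyFunction crossRatio)
open Summit.CriticalPhenomena.CardyFormulaZ2.Cruxes.SquareFromVoronoiHub.VoronoiBlocks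
  (zGs Gs crudeCrossing siteCrossingProb voronoiCrossingProb squareFromVoronoiHub_iff)

namespace Summit.CriticalPhenomena.CardyFormulaZ2.Cruxes.SquareFromVoronoiHub.PoissonDilutionLeg

namespace LatticeDictionary

/-! ### Coordinates of the position maps -/

/-- Real part of a lattice position. [folklore] -/
@[simp] theorem zZ2_re (w : ℤ × ℤ) : (zZ2 w).re = (w.1 : ℝ) := by
  simp [zZ2]

/-- Imaginary part of a lattice position. [folklore] -/
@[simp] theorem zZ2_im (w : ℤ × ℤ) : (zZ2 w).im = (w.2 : ℝ) := by
  simp [zZ2]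

/-- Real part of a rational position. [folklore] -/
@[simp] theorem zQ2_re (q : ℚ × ℚ) : (zQ2 q).re = (q.1 : ℝ) := by
  simp [zQ2]

/-- Imaginary part of a rational position. [folklore] -/
@[simp] theorem zQ2_im (q : ℚ × ℚ) : (zQ2 q).im = (q.2 : ℝ) := by
  simp [zQ2]

/-- Real part of a face centre. [folklore] -/
theorem zGs_inr_re (f : ℤ × ℤ) : (zGs (Sum.inr f)).re = (f.1 : ℝ) + 1 / 2 := by
  rw [← zQ2_hubCoin, zQ2_re, hubCoin]
  push_cast
  ring

/-- Imaginary part of a face centre. [folklore] -/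
theorem zGs_inr_im (f : ℤ × ℤ) : (zGs (Sum.inr f)).im = (f.2 : ℝ) + 1 / 2 := by
  rw [← zQ2_hubCoin, zQ2_im, hubCoin]
  push_cast
  ring

/-- `zZ2` is injective. [folklore] -/
theorem zZ2_injective : Function.Injective zZ2 := by
  intro v w h
  have h1 := congrArg Complex.re h
  have h2 := congrArg Complex.im h
  simp only [zZ2_re, zZ2_im, Int.cast_inj] at h1 h2
  exact Prod.ext h1 h2

/-- `zQ2` is injective. [folklore] -/
theorem zQ2_injective : Function.Injective zQ2 := by
  intro q q' h
  have h1 := congrArg Complex.re h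
  have h2 := congrArg Complex.im h
  simp only [zQ2_re, zQ2_im, Rat.cast_inj] at h1 h2
  exact Prod.ext h1 h2

/-! ### (i) The Voronoi cells of `ℤ²` are the closed unit squares -/

/-- Distance from a point to a lattice point, in coordinates. [folklore] -/
theorem dist_zZ2 (z : ℂ) (w : ℤ × ℤ) :
    dist z (zZ2 w) = √((z.re - w.1) ^ 2 + (z.im - w.2) ^ 2) := by
  rw [Complex.dist_eq_re_im, zZ2_re, zZ2_im]

/-- One coordinate: an integer within `1/2` of `x` is a nearest integer to `x`. [folklore] -/
theorem abs_sub_int_le {x : ℝ} {a : ℤ} (h : |x - a| ≤ 1 / 2) (a' : ℤ) : |x - a| ≤ |x - a'| := by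
  by_cases haa : a = a'
  · rw [haa]
  · have h1 : (1 : ℝ) ≤ |(a : ℝ) - a'| := by exact_mod_cast Int.one_le_abs (sub_ne_zero.2 haa)
    have h2 : |(a : ℝ) - a'| ≤ |(a : ℝ) - x| + |x - a'| := abs_sub_le _ _ _
    rw [abs_sub_comm (a : ℝ) x] at h2
    linarith

/-- (A) A lattice point whose closed unit square contains `z` is a nearest lattice point of `z`.
[folklore] -/
theorem dist_zZ2_le_of_near {z : ℂ} {w : ℤ × ℤ} (h1 : |z.re - w.1| ≤ 1 / 2)
    (h2 : |z.im - w.2| ≤ 1 / 2) (w' : ℤ × ℤ) : dist z (zZ2 w) ≤ dist z (zZ2 w') := by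
  rw [dist_zZ2, dist_zZ2]
  exact Real.sqrt_le_sqrt
    (add_le_add (sq_le_sq.2 (abs_sub_int_le h1 w'.1)) (sq_le_sq.2 (abs_sub_int_le h2 w'.2)))

/-- (B) If `z` is not in the closed unit square about `w`, the rounded lattice point is strictly
closer to `z` than `w`. [folklore] -/
theorem dist_round_lt_of_not_near {z : ℂ} {w : ℤ × ℤ}
    (h : ¬(|z.re - w.1| ≤ 1 / 2 ∧ |z.im - w.2| ≤ 1 / 2)) :
    dist z (zZ2 (round z.re, round z.im)) < dist z (zZ2 w) := by
  rw [dist_zZ2, dist_zZ2]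
  apply Real.sqrt_lt_sqrt (by positivity)
  rcases not_and_or.1 h with h | h
  · rw [not_le] at h
    exact add_lt_add_of_lt_of_le (sq_lt_sq.2 ((abs_sub_round z.re).trans_lt h))
      (sq_le_sq.2 (abs_sub_int_le (abs_sub_round z.im) w.2))
  · rw [not_le] at h
    exact add_lt_add_of_le_of_lt (sq_le_sq.2 (abs_sub_int_le (abs_sub_round z.re) w.1))
      (sq_lt_sq.2 ((abs_sub_round z.im).trans_lt h))

/-- `z` lies in the closed unit square about `w` iff `w` is at least as close to `z` as the
rounded lattice point. [folklore] -/
theorem near_iff_dist_le {z : ℂ} {w : ℤ × ℤ} :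
    (|z.re - w.1| ≤ 1 / 2 ∧ |z.im - w.2| ≤ 1 / 2) ↔
      dist z (zZ2 w) ≤ dist z (zZ2 (round z.re, round z.im)) := by
  refine ⟨fun h => dist_zZ2_le_of_near h.1 h.2 _, fun h => ?_⟩
  by_contra hn
  exact (dist_round_lt_of_not_near hn).not_ge h

/-- The distance from `z` to a set of lattice points containing the rounded point is the distance
to the rounded point. [folklore] -/
theorem infDist_image_zZ2_eq {z : ℂ} {S : Set (ℤ × ℤ)} (h : (round z.re, round z.im) ∈ S) :
    infDist z (zZ2 '' S) = dist z (zZ2 (round z.re, round z.im)) := by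
  refine le_antisymm (infDist_le_dist_of_mem (mem_image_of_mem _ h))
    ((le_infDist ⟨_, mem_image_of_mem _ h⟩).2 ?_)
  rintro _ ⟨w, -, rfl⟩
  exact dist_zZ2_le_of_near (abs_sub_round _) (abs_sub_round _) w

/-- The distance from `z` to the lattice is the distance to the rounded point. [folklore] -/
theorem infDist_range_zZ2 (z : ℂ) :
    infDist z (range zZ2) = dist z (zZ2 (round z.re, round z.im)) := by
  rw [← image_univ]
  exact infDist_image_zZ2_eq (mem_univ _)

/-- Distinct lattice points are at distance at least `1`. [folklore] -/
theorem one_le_dist_zZ2 {v w : ℤ × ℤ} (h : v ≠ w) : 1 ≤ dist (zZ2 v) (zZ2 w) := by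
  rw [dist_eq_norm]
  have hre : (zZ2 v - zZ2 w).re = (v.1 : ℝ) - w.1 := by simp
  have him : (zZ2 v - zZ2 w).im = (v.2 : ℝ) - w.2 := by simp
  by_cases h1 : v.1 = w.1
  · have h2 : v.2 ≠ w.2 := fun h2 => h (Prod.ext h1 h2)
    have : (1 : ℝ) ≤ |(v.2 : ℝ) - w.2| := by exact_mod_cast Int.one_le_abs (sub_ne_zero.2 h2)
    calc (1 : ℝ) ≤ |(zZ2 v - zZ2 w).im| := by rwa [him]
      _ ≤ ‖zZ2 v - zZ2 w‖ := Complex.abs_im_le_norm _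
  · have : (1 : ℝ) ≤ |(v.1 : ℝ) - w.1| := by exact_mod_cast Int.one_le_abs (sub_ne_zero.2 h1)
    calc (1 : ℝ) ≤ |(zZ2 v - zZ2 w).re| := by rwa [hre]
      _ ≤ ‖zZ2 v - zZ2 w‖ := Complex.abs_re_le_norm _

/-- (C, closedness) Any set of lattice points is closed in `ℂ`. [folklore] -/
theorem isClosed_image_zZ2 (S : Set (ℤ × ℤ)) : IsClosed (zZ2 '' S) := by
  refine isClosed_of_pairwise_le_dist one_pos ?_
  rintro _ ⟨v, -, rfl⟩ _ ⟨w, -, rfl⟩ hne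
  exact one_le_dist_zZ2 fun hvw => hne (congrArg zZ2 hvw)

/-- (C) The distance from `z` to a nonempty set of lattice points is attained. [folklore] -/
theorem exists_infDist_image_zZ2 (z : ℂ) {S : Set (ℤ × ℤ)} (hS : S.Nonempty) :
    ∃ v ∈ S, infDist z (zZ2 '' S) = dist z (zZ2 v) := by
  obtain ⟨_, ⟨v, hv, rfl⟩, h⟩ := (isClosed_image_zZ2 S).exists_infDist_eq_dist (hS.image _) z
  exact ⟨v, hv, h⟩

/-- **(i) The black Voronoi cells of a two-coloured `ℤ²` are the closed unit squares about the
black sites**: for `B` and `Bᶜ` nonempty, `z` is at least as close to `zZ2 '' B` as to `zZ2 '' Bᶜ`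
iff `z` lies in the closed unit square about some black site. [folklore] -/
theorem mem_blackRegion_image_zZ2_iff {B : Set (ℤ × ℤ)} (hB : B.Nonempty) (hW : Bᶜ.Nonempty)
    (z : ℂ) :
    z ∈ blackRegion (zZ2 '' B) (zZ2 '' Bᶜ) ↔
      ∃ v ∈ B, |z.re - (v.1 : ℝ)| ≤ 1 / 2 ∧ |z.im - (v.2 : ℝ)| ≤ 1 / 2 := by
  rw [Literature.Probability.Percolation.mem_blackRegion]
  constructor
  · intro hz
    by_cases hr : (round z.re, round z.im) ∈ B
    · exact ⟨_, hr, abs_sub_round _, abs_sub_round _⟩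
    · obtain ⟨v, hv, hvd⟩ := exists_infDist_image_zZ2 z hB
      refine ⟨v, hv, near_iff_dist_le.2 ?_⟩
      rw [← hvd]
      exact hz.trans (infDist_le_dist_of_mem (mem_image_of_mem _ (mem_compl hr)))
  · rintro ⟨v, hv, h1, h2⟩
    refine (infDist_le_dist_of_mem (mem_image_of_mem _ hv)).trans ((le_infDist (hW.image _)).2 ?_)
    rintro _ ⟨w, -, rfl⟩
    exact dist_zZ2_le_of_near h1 h2 w

/-! ### (ii) The hubs of the full lattice are the face centres -/

/-- The nearest lattice points of `p` are the lattice points whose closed unit square contains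
`p`. [folklore] -/
theorem nearest_set_eq (p : ℂ) :
    {n : ℂ | n ∈ range zZ2 ∧ dist p n = infDist p (range zZ2)} =
      zZ2 '' ({a : ℤ | |p.re - (a : ℝ)| ≤ 1 / 2} ×ˢ {b : ℤ | |p.im - (b : ℝ)| ≤ 1 / 2}) := by
  ext n
  simp only [mem_setOf_eq, mem_image, mem_prod, mem_range]
  rw [infDist_range_zZ2]
  constructor
  · rintro ⟨⟨w, rfl⟩, hd⟩
    exact ⟨w, near_iff_dist_le.2 hd.le, rfl⟩
  · rintro ⟨w, hw, rfl⟩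
    exact ⟨⟨w, rfl⟩, le_antisymm (near_iff_dist_le.1 hw)
      (dist_zZ2_le_of_near (abs_sub_round _) (abs_sub_round _) w)⟩

/-- The integers within `1/2` of `x` are among `⌊x⌋`, `⌊x⌋ + 1`. [folklore] -/
theorem int_near_subset (x : ℝ) :
    {a : ℤ | |x - (a : ℝ)| ≤ 1 / 2} ⊆ ({⌊x⌋, ⌊x⌋ + 1} : Set ℤ) := by
  intro a ha
  rw [mem_setOf_eq, abs_le] at ha
  obtain ⟨h1, h2⟩ := ha
  have hf1 : (⌊x⌋ : ℝ) ≤ x := Int.floor_le x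
  have hf2 : x < (⌊x⌋ : ℝ) + 1 := Int.lt_floor_add_one x
  have h3 : ⌊x⌋ < a + 1 := by
    have : (⌊x⌋ : ℝ) < (a : ℝ) + 1 := by linarith
    exact_mod_cast this
  have h4 : a < ⌊x⌋ + 2 := by
    have : (a : ℝ) < (⌊x⌋ : ℝ) + 2 := by linarith
    exact_mod_cast this
  simp only [mem_insert_iff, mem_singleton_iff]
  omega

/-- At most two integers are within `1/2` of `x`. [folklore] -/
theorem encard_int_near_le (x : ℝ) : ({a : ℤ | |x - (a : ℝ)| ≤ 1 / 2}).encard ≤ 2 :=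
  (encard_le_encard (int_near_subset x)).trans (encard_pair (lt_add_one _).ne).le

/-- Two distinct integers are within `1/2` of `x` only if `x = ⌊x⌋ + 1/2`. [folklore] -/
theorem eq_floor_add_half {x : ℝ} {a a' : ℤ} (ha : |x - (a : ℝ)| ≤ 1 / 2)
    (ha' : |x - (a' : ℝ)| ≤ 1 / 2) (hne : a ≠ a') : x = ⌊x⌋ + 1 / 2 := by
  have hm := int_near_subset x ha
  have hm' := int_near_subset x ha'
  simp only [mem_insert_iff, mem_singleton_iff] at hm hm'
  rw [abs_le] at ha ha'
  obtain ⟨h1, h2⟩ := ha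
  obtain ⟨h1', h2'⟩ := ha'
  rcases hm with rfl | rfl <;> rcases hm' with rfl | rfl
  · exact absurd rfl hne
  · push_cast at h1' h2'
    linarith
  · push_cast at h1 h2
    linarith
  · exact absurd rfl hne

/-- The two integers `n`, `n + 1` are within `1/2` of `n + 1/2`. [folklore] -/
theorem two_le_encard_int_near (n : ℤ) :
    2 ≤ ({a : ℤ | |((n : ℝ) + 1 / 2) - (a : ℝ)| ≤ 1 / 2}).encard := by
  calc (2 : ℕ∞) = ({n, n + 1} : Set ℤ).encard := (encard_pair (lt_add_one n).ne).symm
    _ ≤ _ := encard_le_encard ?_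
  intro a ha
  simp only [mem_insert_iff, mem_singleton_iff] at ha
  rw [mem_setOf_eq, abs_le]
  rcases ha with rfl | rfl
  · constructor <;> linarith
  · push_cast
    constructor <;> linarith

/-- **(ii) Counting nearest lattice points**: `p` has at least four lattice points whose closed
unit squares contain it iff both coordinates of `p` are half-integers, i.e. `p` is a face centre.
[folklore] -/
theorem four_le_encard_near_iff (p : ℂ) :
    4 ≤ ({a : ℤ | |p.re - (a : ℝ)| ≤ 1 / 2} ×ˢ {b : ℤ | |p.im - (b : ℝ)| ≤ 1 / 2}).encard ↔
      ∃ f : ℤ × ℤ, p = zGs (Sum.inr f) := by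
  rw [encard_prod]
  constructor
  · intro h
    have hx : 1 < ({a : ℤ | |p.re - (a : ℝ)| ≤ 1 / 2}).encard := by
      by_contra! hle
      have h4 : (4 : ℕ∞) ≤ 1 * 2 := h.trans (mul_le_mul' hle (encard_int_near_le p.im))
      norm_num at h4
    have hy : 1 < ({b : ℤ | |p.im - (b : ℝ)| ≤ 1 / 2}).encard := by
      by_contra! hle
      have h4 : (4 : ℕ∞) ≤ 2 * 1 := h.trans (mul_le_mul' (encard_int_near_le p.re) hle)
      norm_num at h4
    obtain ⟨a, a', ha, ha', hne⟩ := one_lt_encard_iff.1 hx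
    obtain ⟨b, b', hb, hb', hne'⟩ := one_lt_encard_iff.1 hy
    refine ⟨(⌊p.re⌋, ⌊p.im⌋), Complex.ext ?_ ?_⟩
    · rw [zGs_inr_re]
      exact eq_floor_add_half ha ha' hne
    · rw [zGs_inr_im]
      exact eq_floor_add_half hb hb' hne'
  · rintro ⟨f, rfl⟩
    rw [zGs_inr_re, zGs_inr_im]
    calc (4 : ℕ∞) = 2 * 2 := by norm_num
      _ ≤ _ := mul_le_mul' (two_le_encard_int_near f.1) (two_le_encard_int_near f.2)

/-! ### Assembly -/

/-- The black nuclei of the embedded lattice-end configuration are the black sites. [folklore] -/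
theorem blackNuclei_toLeg (θ : LatConfig) : blackNuclei (toLeg θ) = zZ2 '' θ.1 := by
  simp [blackNuclei, toLeg]

/-- The white nuclei of the embedded lattice-end configuration are the white sites. [folklore] -/
theorem whiteNuclei_toLeg (θ : LatConfig) : whiteNuclei (toLeg θ) = zZ2 '' θ.1ᶜ := by
  simp [whiteNuclei, toLeg, compl_eq_univ_sdiff]

/-- All of `ℤ²` is the nucleus set of the embedded lattice-end configuration. [folklore] -/
theorem nuclei_toLeg (θ : LatConfig) : nuclei (toLeg θ) = range zZ2 := by
  rw [nuclei, blackNuclei_toLeg, whiteNuclei_toLeg, ← image_union, union_compl_self, image_univ]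

/-- **(ii) The hubs of the full lattice are exactly the face centres.** [folklore] -/
theorem mem_hubs_toLeg_iff (θ : LatConfig) (p : ℂ) :
    p ∈ hubs (toLeg θ) ↔ ∃ f : ℤ × ℤ, p = zGs (Sum.inr f) := by
  rw [hubs, mem_setOf_eq, nuclei_toLeg, nearest_set_eq, zZ2_injective.encard_image,
    four_le_encard_near_iff]

/-- **(iii) Coins**: the face centre of `f` misses every black hub coin iff `hubCoin f` is not
black. [folklore] -/
theorem forall_zQ2_ne_iff (C : Set (ℚ × ℚ)) (f : ℤ × ℤ) :
    (∀ q ∈ C, zQ2 q ≠ zGs (Sum.inr f)) ↔ hubCoin f ∉ C := by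
  refine ⟨fun h hf => h _ hf (zQ2_hubCoin f), fun hf q hq hq' => hf ?_⟩
  rw [← zQ2_hubCoin] at hq'
  rwa [← zQ2_injective hq']

end LatticeDictionary

/-- **Stub `stub_latticeDictionary` (the cells-and-hubs dictionary).**  With no Poisson nuclei and
every lattice site present, and both colours occurring, the closed black Voronoi cells are the
closed unit squares about the black sites (i), the hubs are exactly the face centres
`zGs (Sum.inr f)` (ii), and a face centre is removed iff its hub coin `hubCoin f` is not black
(iii): `legBlackRegion (toLeg θ) = latBlack θ`. [folklore] -/
theorem stub_latticeDictionary : ∀ θ : LatConfig, θ.1.Nonempty → θ.1ᶜ.Nonempty →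
    legBlackRegion (toLeg θ) = latBlack θ := by
  intro θ hB hW
  have h2 : (toLeg θ).2 = θ.2 := rfl
  ext z
  simp only [legBlackRegion, latBlack, Set.mem_sdiff, mem_setOf_eq,
    LatticeDictionary.blackNuclei_toLeg, LatticeDictionary.whiteNuclei_toLeg,
    LatticeDictionary.mem_hubs_toLeg_iff, h2]
  rw [LatticeDictionary.mem_blackRegion_image_zZ2_iff hB hW]
  refine and_congr_right fun _ => not_congr ⟨?_, ?_⟩
  · rintro ⟨⟨f, rfl⟩, hq⟩
    exact ⟨f, (LatticeDictionary.forall_zQ2_ne_iff θ.2 f).1 hq, rfl⟩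
  · rintro ⟨f, hf, rfl⟩
    exact ⟨⟨f, rfl⟩, (LatticeDictionary.forall_zQ2_ne_iff θ.2 f).2 hf⟩

end Summit.CriticalPhenomena.CardyFormulaZ2.Cruxes.SquareFromVoronoiHub.PoissonDilutionLeg

end
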